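import Literature.Computability.AlgebraicComplexity.QuantumFunctionalsProofs
import HarnessLib

/-!
# Quantum marginals of scaled and direct-sum tensors

Topic `Literature/Computability/AlgebraicComplexity`; support file for the proof of
Christandl–Vrana–Zuiddam, *Universal points in the asymptotic spectrum of tensors* (JAMS 36 (2023)),
Thm. 3.19.2 = Lem. 3.22 (super-additivity of the lower quantum functional
`F_θ = quantumFunctional θ`, `QuantumFunctionals.lean`), towards Cor. 3.31
(`ChristandlVranaZuiddam2023_mem_asymptoticSpectrum`). It computes the unnormalised quantum
marginals `reducedDensityⱼ` (`|t⟩⟨t|ⱼ`, §3.2) and squared norms of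

* a scalar multiple `c • t` (`|ct⟩⟨ct|ⱼ = ‖c‖² |t⟩⟨t|ⱼ`; Rem. 3.17, rescaling inner products),
* a direct sum `s ⊕ t` (`|s ⊕ t⟩⟨s ⊕ t|ⱼ = |s⟩⟨s|ⱼ ⊕ |t⟩⟨t|ⱼ`, block diagonal; proof of Lem. 3.22:
  "the reduced states are related as `ρᵘ_S = p ρˢ_S ⊕ (1-p) ρᵗ_S`"),

and the compatibility of the action `actTensor` with scalars and with `⊕` (block-diagonal matrices
act blockwise: the embedding `G_s × G_t → G_{s ⊕ t}`). The Kronecker-product analogues are in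
`QuantumFunctionalsKronecker.lean`; the entropy consequences are in
`QuantumFunctionalsDirectSumEntropy.lean`. No definitions are introduced.

Reference: M. Christandl, P. Vrana, J. Zuiddam, JAMS 36 (2023) 31–79 = arXiv:1709.07851v3, §3.2
(Rem. 3.17, Lem. 3.21–3.22).
-/

noncomputable section

open scoped BigOperators Matrix Kronecker ComplexOrder
open Real (negMulLog)

namespace Literature.Computability.AlgebraicComplexity

/-! ## More `directSumTensor` simp lemmas -/

section Apply

variable {K : Type*} [CommSemiring K] {ι κ μ ι' κ' μ' : Type*}

/-- Mixed positions of a direct sum vanish. [folklore] -/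
@[simp] theorem directSumTensor_inl_inl_inr (s : ι → κ → μ → K) (t : ι' → κ' → μ' → K) (a : ι)
    (b : κ) (c : μ') : directSumTensor s t (Sum.inl a) (Sum.inl b) (Sum.inr c) = 0 := rfl

/-- Mixed positions of a direct sum vanish. [folklore] -/
@[simp] theorem directSumTensor_inr_inr_inl (s : ι → κ → μ → K) (t : ι' → κ' → μ' → K) (a : ι')
    (b : κ') (c : μ) : directSumTensor s t (Sum.inr a) (Sum.inr b) (Sum.inl c) = 0 := rfl

/-- `0 ⊕ 0 = 0`. [folklore] -/
theorem directSumTensor_zero_zero :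
    directSumTensor (0 : ι → κ → μ → K) (0 : ι' → κ' → μ' → K) = 0 := by
  funext a b c
  rcases a with a | a <;> rcases b with b | b <;> rcases c with c | c <;> rfl

/-- `s ⊕ t = 0` iff `s = 0` and `t = 0`. [folklore] -/
theorem directSumTensor_eq_zero_iff (s : ι → κ → μ → K) (t : ι' → κ' → μ' → K) :
    directSumTensor s t = 0 ↔ s = 0 ∧ t = 0 := by
  constructor
  · intro h
    refine ⟨?_, ?_⟩
    · funext a b c
      simpa using congrFun (congrFun (congrFun h (Sum.inl a)) (Sum.inl b)) (Sum.inl c)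
    · funext a b c
      simpa using congrFun (congrFun (congrFun h (Sum.inr a)) (Sum.inr b)) (Sum.inr c)
  · rintro ⟨rfl, rfl⟩
    exact directSumTensor_zero_zero

end Apply

section Marginals

variable {ι κ μ : Type*} [Fintype ι] [Fintype κ] [Fintype μ]

/-! ## Scalar multiples -/

omit [Fintype ι] in
/-- `|ct⟩⟨ct|₁ = ‖c‖² |t⟩⟨t|₁`. [folklore] -/
theorem reducedDensity₁_smul (c : ℂ) (t : ι → κ → μ → ℂ) :
    reducedDensity₁ (c • t) = ((‖c‖ ^ 2 : ℝ) : ℂ) • reducedDensity₁ t := by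
  ext a a'
  simp only [reducedDensity₁_apply, Pi.smul_apply, smul_eq_mul, Matrix.smul_apply, Finset.mul_sum]
  have hc : c * (starRingEnd ℂ) c = ((‖c‖ ^ 2 : ℝ) : ℂ) := by
    rw [Complex.mul_conj, Complex.normSq_eq_norm_sq]
  refine Finset.sum_congr rfl fun b _ => Finset.sum_congr rfl fun c' _ => ?_
  rw [← hc, star_mul']
  simp only [Complex.star_def]
  ring

omit [Fintype κ] in
/-- `|ct⟩⟨ct|₂ = ‖c‖² |t⟩⟨t|₂`. [folklore] -/
theorem reducedDensity₂_smul (c : ℂ) (t : ι → κ → μ → ℂ) :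
    reducedDensity₂ (c • t) = ((‖c‖ ^ 2 : ℝ) : ℂ) • reducedDensity₂ t := by
  ext b b'
  simp only [reducedDensity₂_apply, Pi.smul_apply, smul_eq_mul, Matrix.smul_apply, Finset.mul_sum]
  have hc : c * (starRingEnd ℂ) c = ((‖c‖ ^ 2 : ℝ) : ℂ) := by
    rw [Complex.mul_conj, Complex.normSq_eq_norm_sq]
  refine Finset.sum_congr rfl fun a _ => Finset.sum_congr rfl fun c' _ => ?_
  rw [← hc, star_mul']
  simp only [Complex.star_def]
  ring

omit [Fintype μ] in
/-- `|ct⟩⟨ct|₃ = ‖c‖² |t⟩⟨t|₃`. [folklore] -/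
theorem reducedDensity₃_smul (c : ℂ) (t : ι → κ → μ → ℂ) :
    reducedDensity₃ (c • t) = ((‖c‖ ^ 2 : ℝ) : ℂ) • reducedDensity₃ t := by
  ext d d'
  simp only [reducedDensity₃_apply, Pi.smul_apply, smul_eq_mul, Matrix.smul_apply, Finset.mul_sum]
  have hc : c * (starRingEnd ℂ) c = ((‖c‖ ^ 2 : ℝ) : ℂ) := by
    rw [Complex.mul_conj, Complex.normSq_eq_norm_sq]
  refine Finset.sum_congr rfl fun a _ => Finset.sum_congr rfl fun b _ => ?_
  rw [← hc, star_mul']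
  simp only [Complex.star_def]
  ring

/-- `⟨ct|ct⟩ = ‖c‖² ⟨t|t⟩`. [folklore] -/
theorem tensorNormSq_smul (c : ℂ) (t : ι → κ → μ → ℂ) :
    tensorNormSq (c • t) = ‖c‖ ^ 2 * tensorNormSq t := by
  simp only [tensorNormSq, Pi.smul_apply, smul_eq_mul, norm_mul, mul_pow, Finset.mul_sum]

/-- Scalars can be moved into the first factor of the action:
`c • (A ⊗ B ⊗ C)·t = ((cA) ⊗ B ⊗ C)·t`. [folklore] -/
theorem smul_actTensor_eq_actTensor_smul {ι' κ' μ' : Type*} (c : ℂ) (A : Matrix ι' ι ℂ)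
    (B : Matrix κ' κ ℂ) (C : Matrix μ' μ ℂ) (t : ι → κ → μ → ℂ) :
    c • actTensor A B C t = actTensor (c • A) B C t := by
  funext a b d
  simp only [Pi.smul_apply, smul_eq_mul, actTensor_apply, Matrix.smul_apply, Finset.mul_sum]
  refine Finset.sum_congr rfl fun x _ => Finset.sum_congr rfl fun y _ =>
    Finset.sum_congr rfl fun z _ => ?_
  ring

end Marginals

/-! ## Direct sums -/

section DirectSumMarginals

variable {ι κ μ ι' κ' μ' : Type*} [Fintype ι] [Fintype κ] [Fintype μ] [Fintype ι'] [Fintype κ']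
  [Fintype μ']

omit [Fintype ι] [Fintype ι'] in
/-- `|s ⊕ t⟩⟨s ⊕ t|₁ = |s⟩⟨s|₁ ⊕ |t⟩⟨t|₁` (block diagonal; CVZ, proof of Lem. 3.22).
[cite: ChristandlVranaZuiddam2023, Lem. 3.22] -/
theorem reducedDensity₁_directSumTensor (s : ι → κ → μ → ℂ) (t : ι' → κ' → μ' → ℂ) :
    reducedDensity₁ (directSumTensor s t) =
      Matrix.fromBlocks (reducedDensity₁ s) 0 0 (reducedDensity₁ t) := by
  ext (a | a) (a₂ | a₂) <;>
    simp [reducedDensity₁_apply, Fintype.sum_sum_type, Matrix.fromBlocks_apply₁₁,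
      Matrix.fromBlocks_apply₁₂, Matrix.fromBlocks_apply₂₁, Matrix.fromBlocks_apply₂₂]

omit [Fintype κ] [Fintype κ'] in
/-- `|s ⊕ t⟩⟨s ⊕ t|₂ = |s⟩⟨s|₂ ⊕ |t⟩⟨t|₂`. [cite: ChristandlVranaZuiddam2023, Lem. 3.22] -/
theorem reducedDensity₂_directSumTensor (s : ι → κ → μ → ℂ) (t : ι' → κ' → μ' → ℂ) :
    reducedDensity₂ (directSumTensor s t) =
      Matrix.fromBlocks (reducedDensity₂ s) 0 0 (reducedDensity₂ t) := by
  ext (b | b) (b₂ | b₂) <;>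
    simp [reducedDensity₂_apply, Fintype.sum_sum_type, Matrix.fromBlocks_apply₁₁,
      Matrix.fromBlocks_apply₁₂, Matrix.fromBlocks_apply₂₁, Matrix.fromBlocks_apply₂₂]

omit [Fintype μ] [Fintype μ'] in
/-- `|s ⊕ t⟩⟨s ⊕ t|₃ = |s⟩⟨s|₃ ⊕ |t⟩⟨t|₃`. [cite: ChristandlVranaZuiddam2023, Lem. 3.22] -/
theorem reducedDensity₃_directSumTensor (s : ι → κ → μ → ℂ) (t : ι' → κ' → μ' → ℂ) :
    reducedDensity₃ (directSumTensor s t) =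
      Matrix.fromBlocks (reducedDensity₃ s) 0 0 (reducedDensity₃ t) := by
  ext (c | c) (c₂ | c₂) <;>
    simp [reducedDensity₃_apply, Fintype.sum_sum_type, Matrix.fromBlocks_apply₁₁,
      Matrix.fromBlocks_apply₁₂, Matrix.fromBlocks_apply₂₁, Matrix.fromBlocks_apply₂₂]

/-- `⟨s ⊕ t|s ⊕ t⟩ = ⟨s|s⟩ + ⟨t|t⟩`. [folklore] -/
theorem tensorNormSq_directSumTensor (s : ι → κ → μ → ℂ) (t : ι' → κ' → μ' → ℂ) :
    tensorNormSq (directSumTensor s t) = tensorNormSq s + tensorNormSq t := by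
  simp [tensorNormSq, Fintype.sum_sum_type, Finset.sum_add_distrib]

/-- The action of block-diagonal matrices on a direct sum is blockwise:
`((A ⊕ A') ⊗ (B ⊕ B') ⊗ (C ⊕ C'))·(s ⊕ t) = ((A ⊗ B ⊗ C)·s) ⊕ ((A' ⊗ B' ⊗ C')·t)` (CVZ §3.2, the
embedding `G_s × G_t → G_{s ⊕ t}`). [cite: ChristandlVranaZuiddam2023, Lem. 3.22] -/
theorem actTensor_directSum {ι₂ κ₂ μ₂ ι₂' κ₂' μ₂' : Type*} (A : Matrix ι₂ ι ℂ) (B : Matrix κ₂ κ ℂ)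
    (C : Matrix μ₂ μ ℂ) (A' : Matrix ι₂' ι' ℂ) (B' : Matrix κ₂' κ' ℂ) (C' : Matrix μ₂' μ' ℂ)
    (s : ι → κ → μ → ℂ) (t : ι' → κ' → μ' → ℂ) :
    actTensor (Matrix.fromBlocks A 0 0 A') (Matrix.fromBlocks B 0 0 B') (Matrix.fromBlocks C 0 0 C')
        (directSumTensor s t) =
      directSumTensor (actTensor A B C s) (actTensor A' B' C' t) := by
  funext a b c
  rcases a with a | a <;> rcases b with b | b <;> rcases c with c | c <;>
    simp [actTensor_apply, Fintype.sum_sum_type, Matrix.fromBlocks_apply₁₁,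
      Matrix.fromBlocks_apply₁₂, Matrix.fromBlocks_apply₂₁, Matrix.fromBlocks_apply₂₂]

end DirectSumMarginals


end Literature.Computability.AlgebraicComplexity

end
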